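import Literature.Analysis.FluidPDE.TorusNSBerselliGaldiCriterionLowest
import Literature.Analysis.FluidPDE.TorusNSChessboardTimeAverages
import Literature.Analysis.FluidPDE.TorusNSVelocityLsBudget
import HarnessLib

/-!
# Pressure budgets in `L^m(T³)`, `3 < m < ∞`, for classical Navier–Stokes solutions

Analysis/FluidPDE proof file (theorems only; no definitions, no named facts).

Search for candidate a priori estimates; no regularity claim. The Calderón–Zygmund pressure bound
`‖p − ⟨p⟩‖ₘ ≤ C‖|u|²‖ₘ` (`Torus.exists_pressure_sub_average_Ls_le_normSq`,
`TorusNSBerselliGaldiCriterionLowest.lean`; Berselli–Galdi 2002, (1.6)) converts every a priori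
time-integrability statement for `‖u‖_{2m}` into one for `‖p − ⟨p⟩‖ₘ` (Berselli–Galdi 2002,
Remark 1.2: "`p ∈ L^r(0,T; L^s)`, `2/r + n/s = n`" in the energy class; Sohr–von Wahl 1986). Here
the chessboard row `n = 0` (Gibbon 2019 Thm 1; tree
`Torus.exists_classicalNS_integral_norm_rpow_le`: `∫₀ᵀ ‖u‖_{2m}^{2m/(2m−3)} ≤ K₀Φ_m`, `3 < m < ∞`,
explicit `Φ_m(ν, T, ‖u₀‖₂²)`) gives

* `Torus.exists_classicalNS_integral_pressureLs_rpow_le_low` (appended 2026-08-20) — for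
  `1 < s ≤ 3`: `∫₀ᵀ (∫|p(t) − ⟨p(t)⟩|^s)^{2/(3(s−1))} dt ≤ K ‖u₀‖₂^{2(3−s)/(3(s−1))} ‖u₀‖₂²/(2ν)`,
  i.e. "`p ∈ L^{2s/3(s−1)}(0,T;L^s)` for `1 < s ≤ 3`" (Robinson–Rodrigo–Sadowski 2016, Cor 5.2
  (5.13) and footnote 1: `‖p‖ₛ ≤ Cₛ‖u‖²_{2s}` and the interpolation class
  `u ∈ L^{4s'/(3(s'−2))}(0,T;L^{s'})`, `s' = 2s ∈ (2, 6]`, tree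
  `Torus.exists_classicalNS_integral_Ls_rpow_le_interpolation`); at `s = 2` this is the
  `L^{4/3}L²` budget of `TorusNSPressureL2Budget`, at `s = 3`: `∫₀ᵀ‖p − ⟨p⟩‖₃ ≤ K‖u₀‖₂²/(2ν)`.
* `Torus.exists_classicalNS_integral_pressureLs_rpow_le` — for `3 < m < ∞`:
  `∫₀ᵀ (∫|p(t) − ⟨p(t)⟩|^m)^{1/(2m−3)} dt ≤ K Φ_m(ν, T, ‖u₀‖₂²)`, i.e. `‖p − ⟨p⟩‖ₘ^{m/(2m−3)}` is a
  priori integrable in time along classical mean-zero solutions on `[0, T] × T³` (`2/r + 3/s =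
  4 − 3/m` at `(r, s) = (m/(2m−3), m)` — the budget side; the criterion side
  `Torus.classicalNS_continuation_of_pressureLs_rpow_integral_le` needs the exponent `2m/(2m−3)`,
  twice as large, Gibbon's factor `2`).

Scope: classical solutions with mean-zero velocity slices on the unit torus; constants inexplicit
(`K = C^{m/(2m−3)} K₀`).

## Mathlib / tree search

Tree (used): `Torus.exists_pressure_sub_average_Ls_le_normSq` (`TorusNSBerselliGaldiCriterionLowest`),
`Torus.exists_classicalNS_integral_norm_rpow_le` (`TorusNSChessboardTimeAverages`),
`Torus.eventually_norm_sub_lt_of_continuousOn` (`TorusSpaceTime`). Searched (`lean search`):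
`pressureLs_rpow_le|integral_pressure.*budget|pressureL2_rpow` — only the `L²` budget
`Torus.exists_classicalNS_integral_pressureL2_rpow_le` (`TorusNSPressureL2Budget`, `(r,s) = (4/3,2)`).

## References

* [BerselliGaldi2002] L. C. Berselli, G. P. Galdi, *Regularity criteria involving the pressure for
  the weak solutions to the Navier–Stokes equations*, Proc. Amer. Math. Soc. 130 (2002)
  3585–3595, (1.6) and Remark 1.2 (held text p. 3).
* [RobinsonRodrigoSadowski2016] J. C. Robinson, J. L. Rodrigo, W. Sadowski, *The Three-Dimensional
  Navier–Stokes Equations*, CUP 2016, Corollary 5.2, (5.13) with footnote 1 (held text p. 88).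
* [Gibbon2019Chessboard] J. D. Gibbon, *Weak and strong solutions of the 3D Navier–Stokes equations
  and their relation to a chessboard of convergent inverse length scales*, J. Nonlinear Sci. 29
  (2019), Thm 1 (row `n = 0`).
-/

noncomputable section

open Set MeasureTheory intervalIntegral Filter Real
open scoped InnerProductSpace RealInnerProductSpace Topology ENNReal NNReal

namespace Literature.Analysis.FluidPDE

open Literature.Analysis.FunctionSpaces

variable {d : Type*} [Fintype d] [DecidableEq d]

/-! ### Pressure budgets from the velocity chessboard (row `n = 0`) -/

omit [DecidableEq d] in
/-- Continuity of `t ↦ ∫ φ(t, x) dx` on `S` (tube lemma on the compact torus). [folklore] -/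
private theorem continuousOn_integral_of_continuousOn_stLift₄ {S : Set ℝ}
    {φ : ℝ → UnitAddTorus d → ℝ} (hφ : ContinuousOn (Torus.stLift φ) (S ×ˢ univ))
    (hsl : ∀ t ∈ S, Continuous (φ t)) : ContinuousOn (fun t => ∫ x, φ t x) S := by
  intro t ht
  rw [ContinuousWithinAt, Metric.tendsto_nhds]
  intro ε hε
  have h := Torus.eventually_norm_sub_lt_of_continuousOn hφ ht (half_pos hε)
  filter_upwards [h, self_mem_nhdsWithin] with s hs hsS
  have his : Integrable (φ s) := (hsl s hsS).integrable_unitAddTorus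
  have hit : Integrable (φ t) := (hsl t ht).integrable_unitAddTorus
  rw [Real.dist_eq, ← integral_sub his hit]
  calc |∫ x, (φ s x - φ t x)| ≤ ∫ x, |φ s x - φ t x| := MeasureTheory.abs_integral_le_integral_abs
    _ ≤ ∫ _x : UnitAddTorus d, ε / 2 := by
        refine integral_mono_of_nonneg (ae_of_all _ fun x => abs_nonneg _) (integrable_const _)
          (ae_of_all _ fun x => ?_)
        have h1 := hs x
        rw [Real.norm_eq_abs] at h1
        exact h1.le
    _ = ε / 2 := by simp
    _ < ε := half_lt_self hε

/-- **Pressure budgets on `T³` in `L^m`, `3 < m < ∞`** (Berselli–Galdi 2002, (1.6) and Remark 1.2: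
the pressure inherits the time-integrability of `|u|²`; here from the chessboard row `n = 0`,
Gibbon 2019 Thm 1, tree `Torus.exists_classicalNS_integral_norm_rpow_le`): on `T^d`,
`card d = 3`, for `3 < m < ∞` there is `K ≥ 0` such that along every classical solution of the
unforced Navier–Stokes equations with `ν > 0` on `[0, T] × T^d`, `T > 0`, with mean-zero
velocity slices,
`∫₀ᵀ (∫ |p(t) − ⟨p(t)⟩|^m)^{1/(2m−3)} dt ≤ K Φ_m(ν, T, ‖u₀‖₂²)`
with the same explicit right-hand side `Φ_m` as the velocity budget
`∫₀ᵀ (∫|u|^{2m})^{1/(2m−3)} ≤ K₀ Φ_m` (i.e. `‖p − ⟨p⟩‖ₘ^{m/(2m−3)}` is a priori integrable in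
time: `‖p − ⟨p⟩‖ₘ ≤ C‖|u|²‖ₘ`, `Torus.exists_pressure_sub_average_Ls_le_normSq`).
[cite: BerselliGaldi2002, (1.6) and Remark 1.2] -/
theorem Torus.exists_classicalNS_integral_pressureLs_rpow_le (hd : Fintype.card d = 3) {m : ℝ}
    (hm : 3 < m) :
    ∃ K : ℝ, 0 ≤ K ∧ ∀ {ν T : ℝ}, 0 < ν → 0 < T →
      ∀ {u : ℝ → UnitAddTorus d → EuclideanSpace ℝ d} {p : ℝ → UnitAddTorus d → ℝ},
        Torus.IsClassicalNSSolutionOn (Icc 0 T) ν 0 u p →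
        (∀ t ∈ Icc 0 T, Torus.HasZeroMean (u t)) →
        ∫ t in (0 : ℝ)..T, (∫ x, |p t x - ∫ y, p t y| ^ m) ^ (1 / (2 * m - 3)) ≤
          K * (1 / ν + 27 * (∫ x, ‖u 0 x‖ ^ 2) / (8 * π ^ 4 * ν ^ 5)) ^
              ((m - 3) / (2 * (2 * m - 3))) *
            (T + (∫ x, ‖u 0 x‖ ^ 2) / (2 * ν)) ^ ((m - 3) / (2 * m - 3)) *
            ((∫ x, ‖u 0 x‖ ^ 2) / (2 * ν)) ^ ((m + 3) / (2 * (2 * m - 3))) := by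
  haveI : Nonempty d := Fintype.card_pos_iff.1 (by rw [hd]; norm_num)
  have hm1 : 1 < m := by linarith
  have hm0 : 0 < m := by linarith
  have h2m : 0 < 2 * m - 3 := by linarith
  obtain ⟨C, hC0, hC⟩ := Torus.exists_pressure_sub_average_Ls_le_normSq (d := d) (γ := m) hm1
  obtain ⟨K₀, hK₀0, hK₀⟩ := Torus.exists_classicalNS_integral_norm_rpow_le (d := d) hd hm
  obtain ⟨e, he, he0⟩ : ∃ e : ℝ, e = m / (2 * m - 3) ∧ 0 < e := ⟨_, rfl, by positivity⟩
  refine ⟨C ^ e * K₀, by positivity, fun {ν T} hν hT {u p} h hmean => ?_⟩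
  have hvel := hK₀ hν hT h hmean
  -- pointwise in time
  have hpt : ∀ t ∈ Icc 0 T, (∫ x, |p t x - ∫ y, p t y| ^ m) ^ (1 / (2 * m - 3)) ≤
      C ^ e * (∫ x, ‖u t x‖ ^ (2 * m)) ^ (1 / (2 * m - 3)) := by
    intro t ht
    have h1 := hC hT h t ht
    have e2 : ∫ x, (‖u t x‖ ^ 2) ^ m = ∫ x, ‖u t x‖ ^ (2 * m) :=
      integral_congr_ae (ae_of_all _ fun x => by
        dsimp only
        rw [← Real.rpow_natCast, ← Real.rpow_mul (norm_nonneg _)]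
        norm_num)
    rw [e2] at h1
    have hq0 : 0 ≤ ∫ x, |p t x - ∫ y, p t y| ^ m :=
      integral_nonneg fun x => Real.rpow_nonneg (abs_nonneg _) _
    have hu0 : 0 ≤ ∫ x, ‖u t x‖ ^ (2 * m) := integral_nonneg fun x => Real.rpow_nonneg (norm_nonneg _) _
    have h2 := Real.rpow_le_rpow (Real.rpow_nonneg hq0 _) h1 he0.le
    have hme : 1 / m * e = 1 / (2 * m - 3) := by
      rw [he, one_div m, inv_mul_eq_div, div_right_comm, div_self hm0.ne']
    rw [← Real.rpow_mul hq0, Real.mul_rpow hC0 (Real.rpow_nonneg hu0 _), ← Real.rpow_mul hu0, hme] at h2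
    exact h2
  -- continuity in time of both integrands on `[0, T]` (tube lemma)
  have hust : ContinuousOn (Torus.stLift u) (Icc 0 T ×ˢ univ) := h.smooth_velocity.continuousOn_stLift
  have hpst : ContinuousOn (Torus.stLift p) (Icc 0 T ×ˢ univ) := h.smooth_pressure.continuousOn_stLift
  have hus : ∀ t ∈ Icc 0 T, Torus.IsSmooth (u t) := fun t ht => h.smooth_velocity.isSmooth_slice ht
  have hps : ∀ t ∈ Icc 0 T, Torus.IsSmooth (p t) := fun t ht => h.smooth_pressure.isSmooth_slice ht
  have hUc : ContinuousOn (fun t => ∫ x, ‖u t x‖ ^ (2 * m)) (Icc 0 T) := by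
    refine continuousOn_integral_of_continuousOn_stLift₄ (φ := fun t x => ‖u t x‖ ^ (2 * m)) ?_
      fun t ht => (hus t ht).continuous.norm.rpow_const fun x => Or.inr (by positivity)
    have e' : Torus.stLift (fun t x => ‖u t x‖ ^ (2 * m)) = fun z => ‖Torus.stLift u z‖ ^ (2 * m) := rfl
    rw [e']
    exact hust.norm.rpow_const fun z _ => Or.inr (by positivity)
  have hMc : ContinuousOn (fun t => ∫ y, p t y) (Icc 0 T) :=
    continuousOn_integral_of_continuousOn_stLift₄ hpst fun t ht => (hps t ht).continuous
  have hPc : ContinuousOn (fun t => ∫ x, |p t x - ∫ y, p t y| ^ m) (Icc 0 T) := by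
    refine continuousOn_integral_of_continuousOn_stLift₄ (φ := fun t x => |p t x - ∫ y, p t y| ^ m) ?_
      fun t ht => ((hps t ht).continuous.sub continuous_const).abs.rpow_const fun x => Or.inr hm0.le
    have e' : Torus.stLift (fun t x => |p t x - ∫ y, p t y| ^ m) =
        fun z => |Torus.stLift p z - (fun t => ∫ y, p t y) z.1| ^ m := rfl
    rw [e']
    have hM2 : ContinuousOn (fun z : ℝ × EuclideanSpace ℝ d => (fun t => ∫ y, p t y) z.1) (Icc 0 T ×ˢ univ) :=
      hMc.comp continuous_fst.continuousOn fun z hz => (mem_prod.1 hz).1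
    exact ((hpst.sub hM2).norm.congr fun z _ => (Real.norm_eq_abs _).symm).rpow_const
      fun z _ => Or.inr hm0.le
  have hLi : IntervalIntegrable (fun t => (∫ x, |p t x - ∫ y, p t y| ^ m) ^ (1 / (2 * m - 3))) volume 0 T :=
    ((hPc.rpow_const fun t _ => Or.inr (by positivity)).mono (by rw [uIcc_of_le hT.le])).intervalIntegrable
  have hRi : IntervalIntegrable (fun t => C ^ e * (∫ x, ‖u t x‖ ^ (2 * m)) ^ (1 / (2 * m - 3))) volume 0 T :=
    ((continuousOn_const.mul (hUc.rpow_const fun t _ => Or.inr (by positivity))).mono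
      (by rw [uIcc_of_le hT.le])).intervalIntegrable
  have hmono := intervalIntegral.integral_mono_on hT.le hLi hRi hpt
  refine hmono.trans ?_
  rw [intervalIntegral.integral_const_mul]
  have := mul_le_mul_of_nonneg_left hvel (by positivity : (0 : ℝ) ≤ C ^ e)
  refine this.trans (le_of_eq ?_)
  ring


/-! ### Pressure budgets in `L^s`, `1 < s ≤ 3`, from the interpolation class of the velocity -/

/-- **Pressure budgets on `T³` in `L^s`, `1 < s ≤ 3`** (Robinson–Rodrigo–Sadowski 2016,
Corollary 5.2, (5.13) with footnote 1: for a weak solution in the absence of boundaries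
"`p ∈ L^r(0,T;L^s)` for `2/r + 3/s = 3`, `s > 1`", equivalently "`p ∈ L^{2s/3(s−1)}(0,T;L^s)` for
`1 < s ≤ 3`", from `‖p‖_{L^s} ≤ C_s‖u‖²_{L^{2s}}` (5.7) and `u ∈ L^r(0,T;L^{2s})`,
`2/r + 3/(2s) = 3/2` (Lemma 3.5); Berselli–Galdi 2002, Remark 1.2): on `T^d`, `card d = 3`, for
`1 < s ≤ 3` there is `K ≥ 0` such that along every classical solution of the unforced
Navier–Stokes equations with `ν > 0` on `[0,T] × T^d`, `T > 0`, with mean-zero velocity slices,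
`∫₀ᵀ (∫ |p(t) − ⟨p(t)⟩|^s)^{2/(3(s−1))} dt ≤ K ‖u₀‖₂^{2(3−s)/(3(s−1))} · ‖u₀‖₂²/(2ν)`
(`‖u₀‖₂² = ∫‖u(0)‖²`), i.e. `‖p − ⟨p⟩‖ₛ^{2s/(3(s−1))}` is a priori integrable in time (tree:
`Torus.exists_pressure_sub_average_Ls_le_normSq` and
`Torus.exists_classicalNS_integral_Ls_rpow_le_interpolation` at `s' = 2s`).
[cite: RobinsonRodrigoSadowski2016, Corollary 5.2 (5.13)] [cite: BerselliGaldi2002, Remark 1.2] -/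
theorem Torus.exists_classicalNS_integral_pressureLs_rpow_le_low (hd : Fintype.card d = 3) {s : ℝ}
    (hs1 : 1 < s) (hs3 : s ≤ 3) :
    ∃ K : ℝ, 0 ≤ K ∧ ∀ {ν T : ℝ}, 0 < ν → 0 < T →
      ∀ {u : ℝ → UnitAddTorus d → EuclideanSpace ℝ d} {p : ℝ → UnitAddTorus d → ℝ},
        Torus.IsClassicalNSSolutionOn (Icc 0 T) ν 0 u p →
        (∀ t ∈ Icc 0 T, Torus.HasZeroMean (u t)) →
        ∫ t in (0 : ℝ)..T, (∫ x, |p t x - ∫ y, p t y| ^ s) ^ (2 / (3 * (s - 1))) ≤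
          (K * (∫ x, ‖u 0 x‖ ^ 2) ^ ((3 - s) / (3 * (s - 1)))) * ((∫ x, ‖u 0 x‖ ^ 2) / (2 * ν)) := by
  haveI : Nonempty d := Fintype.card_pos_iff.1 (by rw [hd]; norm_num)
  have hs0 : 0 < s := by linarith
  have hsm1 : 0 < s - 1 := by linarith
  have he0 : 0 ≤ 2 / (3 * (s - 1)) := by positivity
  obtain ⟨C, hC0, hC⟩ := Torus.exists_pressure_sub_average_Ls_le_normSq (d := d) (γ := s) hs1
  obtain ⟨K₀, hK₀0, hK₀⟩ := Torus.exists_classicalNS_integral_Ls_rpow_le_interpolation (d := d) hd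
    (s := 2 * s) (by linarith) (by linarith)
  obtain ⟨e, he, he0'⟩ : ∃ e : ℝ, e = 2 * s / (3 * (s - 1)) ∧ 0 < e := ⟨_, rfl, by positivity⟩
  refine ⟨C ^ e * K₀, by positivity, fun {ν T} hν hT {u p} h hmean => ?_⟩
  have hvel := hK₀ hν hT h hmean
  -- the exponents of the velocity budget at `s' = 2s`
  have ex1 : 4 / (3 * (2 * s - 2)) = 2 / (3 * (s - 1)) := by
    rw [show 3 * (2 * s - 2) = 2 * (3 * (s - 1)) by ring, div_mul_eq_div_div]; norm_num
  have ex2 : (6 - 2 * s) / (3 * (2 * s - 2)) = (3 - s) / (3 * (s - 1)) := by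
    rw [show 6 - 2 * s = 2 * (3 - s) by ring, show 3 * (2 * s - 2) = 2 * (3 * (s - 1)) by ring,
      mul_div_mul_left _ _ (two_ne_zero)]
  rw [ex1, ex2] at hvel
  -- pointwise in time
  have hpt : ∀ t ∈ Icc 0 T, (∫ x, |p t x - ∫ y, p t y| ^ s) ^ (2 / (3 * (s - 1))) ≤
      C ^ e * (∫ x, ‖u t x‖ ^ (2 * s)) ^ (2 / (3 * (s - 1))) := by
    intro t ht
    have h1 := hC hT h t ht
    have e2 : ∫ x, (‖u t x‖ ^ 2) ^ s = ∫ x, ‖u t x‖ ^ (2 * s) :=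
      integral_congr_ae (ae_of_all _ fun x => by
        dsimp only
        rw [← Real.rpow_natCast, ← Real.rpow_mul (norm_nonneg _)]
        norm_num)
    rw [e2] at h1
    have hq0 : 0 ≤ ∫ x, |p t x - ∫ y, p t y| ^ s :=
      integral_nonneg fun x => Real.rpow_nonneg (abs_nonneg _) _
    have hu0 : 0 ≤ ∫ x, ‖u t x‖ ^ (2 * s) := integral_nonneg fun x => Real.rpow_nonneg (norm_nonneg _) _
    have h2 := Real.rpow_le_rpow (Real.rpow_nonneg hq0 _) h1 he0'.le
    have hme : 1 / s * e = 2 / (3 * (s - 1)) := by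
      rw [he]; field_simp
    rw [← Real.rpow_mul hq0, Real.mul_rpow hC0 (Real.rpow_nonneg hu0 _), ← Real.rpow_mul hu0, hme] at h2
    exact h2
  -- continuity in time of both integrands on `[0, T]` (tube lemma)
  have hust : ContinuousOn (Torus.stLift u) (Icc 0 T ×ˢ univ) := h.smooth_velocity.continuousOn_stLift
  have hpst : ContinuousOn (Torus.stLift p) (Icc 0 T ×ˢ univ) := h.smooth_pressure.continuousOn_stLift
  have hus : ∀ t ∈ Icc 0 T, Torus.IsSmooth (u t) := fun t ht => h.smooth_velocity.isSmooth_slice ht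
  have hps : ∀ t ∈ Icc 0 T, Torus.IsSmooth (p t) := fun t ht => h.smooth_pressure.isSmooth_slice ht
  have h2s0 : 0 ≤ 2 * s := by linarith
  have hUc : ContinuousOn (fun t => ∫ x, ‖u t x‖ ^ (2 * s)) (Icc 0 T) := by
    refine continuousOn_integral_of_continuousOn_stLift₄ (φ := fun t x => ‖u t x‖ ^ (2 * s)) ?_
      fun t ht => (hus t ht).continuous.norm.rpow_const fun x => Or.inr h2s0
    have e' : Torus.stLift (fun t x => ‖u t x‖ ^ (2 * s)) = fun z => ‖Torus.stLift u z‖ ^ (2 * s) := rfl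
    rw [e']
    exact hust.norm.rpow_const fun z _ => Or.inr h2s0
  have hMc : ContinuousOn (fun t => ∫ y, p t y) (Icc 0 T) :=
    continuousOn_integral_of_continuousOn_stLift₄ hpst fun t ht => (hps t ht).continuous
  have hPc : ContinuousOn (fun t => ∫ x, |p t x - ∫ y, p t y| ^ s) (Icc 0 T) := by
    refine continuousOn_integral_of_continuousOn_stLift₄ (φ := fun t x => |p t x - ∫ y, p t y| ^ s) ?_
      fun t ht => ((hps t ht).continuous.sub continuous_const).abs.rpow_const fun x => Or.inr hs0.le
    have e' : Torus.stLift (fun t x => |p t x - ∫ y, p t y| ^ s) =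
        fun z => |Torus.stLift p z - (fun t => ∫ y, p t y) z.1| ^ s := rfl
    rw [e']
    have hM2 : ContinuousOn (fun z : ℝ × EuclideanSpace ℝ d => (fun t => ∫ y, p t y) z.1) (Icc 0 T ×ˢ univ) :=
      hMc.comp continuous_fst.continuousOn fun z hz => (mem_prod.1 hz).1
    exact ((hpst.sub hM2).norm.congr fun z _ => (Real.norm_eq_abs _).symm).rpow_const
      fun z _ => Or.inr hs0.le
  have hLi : IntervalIntegrable (fun t => (∫ x, |p t x - ∫ y, p t y| ^ s) ^ (2 / (3 * (s - 1)))) volume 0 T :=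
    ((hPc.rpow_const fun t _ => Or.inr he0).mono (by rw [uIcc_of_le hT.le])).intervalIntegrable
  have hRi : IntervalIntegrable (fun t => C ^ e * (∫ x, ‖u t x‖ ^ (2 * s)) ^ (2 / (3 * (s - 1))))
      volume 0 T :=
    ((continuousOn_const.mul (hUc.rpow_const fun t _ => Or.inr he0)).mono
      (by rw [uIcc_of_le hT.le])).intervalIntegrable
  have hmono := intervalIntegral.integral_mono_on hT.le hLi hRi hpt
  refine hmono.trans ?_
  rw [intervalIntegral.integral_const_mul]
  have := mul_le_mul_of_nonneg_left hvel (by positivity : (0 : ℝ) ≤ C ^ e)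
  refine this.trans (le_of_eq ?_)
  ring

end Literature.Analysis.FluidPDE

end
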